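import Literature.NumberTheory.GelbartRogawski1991.DoubledBlockDiagEmbeddingDelta
import Literature.NumberTheory.GelbartRogawski1991.DoubledSeesawCharacterRigid
import Literature.NumberTheory.Weil1964.AdelicMetaplecticSeesawRigid
import HarnessLib

/-!
# The doubled see-saw identity for `H(V₁) × H(V₂) ⊂ H(V₁ ⊕ V₂)`: the see-saw scalar of Weil's `δ`'s, the parabolic
# comparison, and «the see-saw character is `1` on `H(V₁)(𝔸) × 1`»

Topic `NumberTheory/GelbartRogawski1991`; namespace `Literature.NumberTheory.GelbartRogawski1991.GRConstruction`; sequel of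
`DoubledBlockDiagEmbedding` / `DoubledBlockDiagEmbeddingDelta` (`σ = idxSplitD`, `blkD`, `toSpD_blkD`, `isSiegelDelta_blkD`,
`chiDet_mul_modDelta_blkD_inl`, `proj_rDelta_split`), `DoubledSeesawCharacterRigid`
(`IsDoubledWeilRep.monoidHom_eq_one_of_forall_isSiegelDelta`) and `Weil1964/AdelicMetaplecticSeesawRigid`
(`mpSeesawCharSum_inl_eq_one_of_rigid`).  Proved theorems and ONE plumbing definition with body (`seesawCharBlkD`, the see-saw
character of the doubled triple); no named fact, no `sorry`.

Setting as in `DoubledBlockDiagEmbedding`: CM field `L`, `V = V₁ ⊕ V₂ = diag (dA ‖ dB)`, one partner `W = diag dW`, the doubled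
groups `H(X)(𝔸)` and their `χ`-normalised doubled Weil representations `sD_X` (`IsDoubledWeilRep`, [GelbartRogawski1991, §3.1
Prop. 3.1.1]; [Kudla1994, Thm. 3.1]).

* §7.0 (private) the pure linear algebra of the parabolic comparison (`seesaw_scalar_eq_one_of_parabolic`) and two
  `Representation` inversion identities;
* §7.1 **`exists_kappa`** — the see-saw scalar `κ ≠ 0` of `(r_Δ(V), r_Δ(V₁), r_Δ(V₂))` through `σ`
  (`exists_ne_zero_smul_tensorToSum_of_fst_eq_spSum` on `proj_rDelta_split`):
  `ω(r_Δ V)(Φ₁ ⊠_σ Φ₂) = κ • (ω(r_Δ V₁)Φ₁ ⊠_σ ω(r_Δ V₂)Φ₂)`, via the general-element forms `proj_sumTransport_of_split`,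
  `exists_seesaw_scalar_sum_of_split`, `exists_seesaw_scalar_of_split`;
* §7.2 `spReindex_proj_comp_blkD` — the hypothesis `hS` of `mpSeesawCharSum` for the triple
  `(sD_V ∘ blkD, sD_{V₁} ∘ pr₁, sD_{V₂} ∘ pr₂)` (`toSpD_blkD` + the three `proj_eq` clauses); **`seesawCharBlkD`** — its see-saw
  character `H(V₁)(𝔸) × H(V₂)(𝔸) →* ℂˣ`, with its defining identity `seesawCharBlkD_spec`;
* §7.3 **`seesawCharBlkD_eq_one_of_isSiegelDelta`** (`hQ`) — `= 1` at `(q, 1)` for `q ∈ P_Δ(V₁)(𝔸)` with unit `det_Δ q`: the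
  two parabolic clauses at `Φ_j := ω(r_Δ)⁻¹ testVec`, compared through `κ` and `chiDet_mul_modDelta_blkD_inl`
  ([Kudla1994, §2, Thm. 3.1]; [HarrisKudlaSweet1996, §1 (1.14)–(1.15)]);
* §7.4 **`seesawCharBlkD_inl_eq_one`** — `= 1` on all of `H(V₁)(𝔸) × 1` by `mpSeesawCharSum_inl_eq_one_of_rigid` and the
  rigidity `IsDoubledWeilRep.monoidHom_eq_one_of_forall_isSiegelDelta`; read on pure `σ`-tensors,
  **`omega_blkD_inl_sumTensor`**: `ω(sD_V (blkD (h₁, 1))) (Φ₁ ⊠_σ Φ₂) = ω(sD_{V₁} h₁) Φ₁ ⊠_σ Φ₂` — the see-saw step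
  «with the SAME μ» of the proof of [Liu2021, Thm. 4.15] (l. 2199–2210), in the doubled-unitary currency.

What is NOT here: the undoubling of `omega_blkD_inl_sumTensor` to the `χ`-splittings of `U(V⋆)(𝔸) ⊂ U(V)(𝔸)` (sequel
`Liu2021/Def411WeilCarriersDoublingSeesawLine`).

## References
* [Kudla1984] S. Kudla, *Seesaw dual reductive pairs*, Progr. Math. 46 (1984) 244–268, §1.
* [Kudla1994] S. Kudla, *Splitting metaplectic covers of dual reductive pairs*, Israel J. Math. 87 (1994), §2, Thm. 3.1.
* [GelbartRogawski1991] S. Gelbart, J. Rogawski, *L-functions and Fourier–Jacobi coefficients for the unitary group U(3)*,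
  Invent. Math. 105 (1991), §3.1 Prop. 3.1.1 p. 455, Remark p. 457.
* [HarrisKudlaSweet1996] M. Harris, S. Kudla, W. Sweet, *Theta dichotomy for unitary groups*, J. AMS 9 (1996), §1 (1.9)–(1.15).
* [MoeglinVignerasWaldspurger1987] C. Mœglin, M.-F. Vignéras, J.-L. Waldspurger, *Correspondances de Howe sur un corps
  p-adique*, LNM 1291 (1987), Chap. 2 II.1.
* [Weil1964] A. Weil, *Sur certains groupes d'opérateurs unitaires*, Acta Math. 111 (1964), Chap. III n° 37–38 pp. 187–189.
* [Liu2021] Y. Liu, *Fourier–Jacobi cycles and arithmetic relative trace formula*, Camb. J. Math. 9 (2021), proof of Thm. 4.15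
  (l. 2199–2210).
-/

set_option autoImplicit false

noncomputable section

open scoped Classical
open scoped Matrix Kronecker
open NumberField IsDedekindDomain
open Literature.RepresentationTheory.HeisenbergGroup
open Literature.NumberTheory.Automorphic
open Literature.NumberTheory.Weil1964
open Literature.RepresentationTheory.HarrisKudlaSweet1996
open Literature.NumberTheory.GaloisRepresentations

/-! ## §7 The see-saw scalar of Weil's `δ`'s, the parabolic comparison `hQ`, the doubled conclusion -/

namespace Literature.NumberTheory.GelbartRogawski1991.GRConstruction

open UnitaryDualPair
open Literature.NumberTheory.Automorphic.Liu2021.Def411WeilCarriersDoubling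

/-! ### §7.0 Pure linear algebra of the parabolic comparison -/

/-- **The parabolic comparison, abstractly.**  Three spaces `PV, PA, PB` with a "tensor" `τ : PA → PB → PV` and evaluation
functionals `ev` multiplicative on `τ`; operators `RV, RA, RB` («`ω(r_Δ)`») compatible with `τ` up to `κ ≠ 0`, with one-sided
inverses `RV', RA', RB'`; an operator `SV` («`ω(sD_V(q,1))`») acting on `τ` as `c • τ (SA ·) (SB ·)` with `SB = id`; and the two
PARABOLIC identities `ev (RV (SV (RV' (τ tA tB)))) = m_V · ev (τ tA tB)`, `ev (RA (SA (RA' tA))) = m_A · ev tA` at test vectors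
with `ev tA = ev tB = 1`.  If `m_V = m_A ≠ 0` then `c = 1`. [folklore] -/
private theorem seesaw_scalar_eq_one_of_parabolic {PV PA PB : Type*} [AddCommGroup PV] [Module ℂ PV] [AddCommGroup PA] [Module ℂ PA]
    [AddCommGroup PB] [Module ℂ PB]
    (τ : PA → PB → PV) (evV : PV → ℂ) (evA : PA → ℂ) (evB : PB → ℂ)
    (hevs : ∀ (a : ℂ) (z : PV), evV (a • z) = a * evV z) (hev : ∀ x y, evV (τ x y) = evA x * evB y)
    (RV RV' SV : PV →ₗ[ℂ] PV) (RA RA' SA : PA →ₗ[ℂ] PA) (RB RB' SB : PB →ₗ[ℂ] PB)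
    (hRV : ∀ z, RV' (RV z) = z) (hRA : ∀ x, RA (RA' x) = x) (hRB : ∀ y, RB (RB' y) = y) (hSB : ∀ y, SB y = y)
    (κ c mA mV : ℂ) (hκ0 : κ ≠ 0) (hmA : mA ≠ 0) (hm : mV = mA)
    (hR : ∀ x y, RV (τ x y) = κ • τ (RA x) (RB y)) (hS : ∀ x y, SV (τ x y) = c • τ (SA x) (SB y))
    (tA : PA) (tB : PB) (htA : evA tA = 1) (htB : evB tB = 1)
    (hparV : evV (RV (SV (RV' (τ tA tB)))) = mV * evV (τ tA tB))
    (hparA : evA (RA (SA (RA' tA))) = mA * evA tA) :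
    c = 1 := by
  -- `RV' (τ tA tB) = κ⁻¹ • τ (RA' tA) (RB' tB)`
  have h1 : RV (τ (RA' tA) (RB' tB)) = κ • τ tA tB := by rw [hR, hRA, hRB]
  have h2 : RV' (τ tA tB) = κ⁻¹ • τ (RA' tA) (RB' tB) := by
    have h := congrArg RV' h1
    rw [hRV, map_smul] at h
    rw [h, smul_smul, inv_mul_cancel₀ hκ0, one_smul]
  -- push `SV`, then `RV`
  have h3 : RV (SV (RV' (τ tA tB))) = c • τ (RA (SA (RA' tA))) tB := by
    rw [h2, map_smul, hS, hSB, map_smul, map_smul, hR, hRB, smul_smul, smul_smul, mul_comm κ⁻¹ c, mul_assoc,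
      inv_mul_cancel₀ hκ0, mul_one]
  rw [h3, hevs, hev, hparA, htA, htB, hev, htA, htB, hm] at hparV
  simp only [mul_one] at hparV
  -- `hparV : c * mA = mA`
  exact mul_right_cancel₀ hmA (hparV.trans (one_mul mA).symm)

/-- `ρ g⁻¹ (ρ g v) = v` for a representation. [folklore] -/
private theorem rep_inv_apply_apply {G V : Type*} [Group G] [AddCommMonoid V] [Module ℂ V] (ρ : Representation ℂ G V) (g : G) (v : V) :
    ρ g⁻¹ (ρ g v) = v := by
  rw [← Module.End.mul_apply, ← map_mul, inv_mul_cancel, map_one, Module.End.one_apply]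

/-- `ρ g (ρ g⁻¹ v) = v` for a representation. [folklore] -/
private theorem rep_apply_inv_apply {G V : Type*} [Group G] [AddCommMonoid V] [Module ℂ V] (ρ : Representation ℂ G V) (g : G) (v : V) :
    ρ g (ρ g⁻¹ v) = v := by
  rw [← Module.End.mul_apply, ← map_mul, mul_inv_cancel, map_one, Module.End.one_apply]

section R1b

variable (L : Type) [Field L] [NumberField L] [IsCMField L]

variable {N₁ N₂ M n n₁ n₂ : ℕ} (eV : Fin (N₁ + N₂) × Fin M ≃ Fin n) (eA : Fin N₁ × Fin M ≃ Fin n₁)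
  (eB : Fin N₂ × Fin M ≃ Fin n₂)

local notation "𝔸⁺" => AdeleRing (𝓞 (Fp L)) (Fp L)

variable (dA : Fin N₁ → L) (hdA : ∀ i, IsCMField.complexConj L (dA i) = dA i) (hdA0 : ∀ i, dA i ≠ 0)
  (dB : Fin N₂ → L) (hdB : ∀ i, IsCMField.complexConj L (dB i) = dB i) (hdB0 : ∀ i, dB i ≠ 0)
  (dV : Fin (N₁ + N₂) → L) (hdV : ∀ i, IsCMField.complexConj L (dV i) = dV i) (hdV0 : ∀ i, dV i ≠ 0)
  (hVA : ∀ i, dV (Fin.castAdd N₂ i) = dA i) (hVB : ∀ j, dV (Fin.natAdd N₁ j) = dB j)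
  (dW : Fin M → L) (hdW : ∀ i, IsCMField.complexConj L (dW i) = dW i) (hdW0 : ∀ i, dW i ≠ 0)

/-! ### §7.1 The see-saw scalar `κ ≠ 0` of `(r_Δ(V), r_Δ(V₁), r_Δ(V₂))` -/

include hdW0 in
/-- `T^𝔻 ⊗ 1` is an invertible matrix (the `IsUnit T_j` hypotheses of ★ `mpSeesawCharSum`).
[cite: GelbartRogawski1991, §3.1 Prop. 3.1.1 p. 455 L1–2] -/
theorem isUnit_gramDA' {N m : ℕ} (e : Fin N × Fin M ≃ Fin m) (d : Fin N → L) (hd : ∀ i, IsCMField.complexConj L (d i) = d i)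
    (hd0 : ∀ i, d i ≠ 0) : IsUnit (gramDA L e d hd dW hdW) :=
  (Matrix.isUnit_iff_isUnit_det _).mpr (isUnit_det_gramDA L e d hd hd0 dW hdW hdW0)

/-- `|det_Δ p|^{1/2} ≠ 0`. [folklore] -/
private theorem modDelta_ne_zero' {N m : ℕ} (e : Fin N × Fin M ≃ Fin m) (d : Fin N → L) (hd : ∀ i, IsCMField.complexConj L (d i) = d i)
    (p : HA L e d hd dW hdW) : modDelta L e d hd dW hdW p ≠ 0 := by
  unfold modDelta
  split_ifs with hu
  · rw [← coe_ideleNorm]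
    exact Real.sqrt_ne_zero'.mpr (NNReal.coe_pos.mpr (pos_iff_ne_zero.mpr (ideleNorm_ne_zero _)))
  · exact one_ne_zero

include hVA hVB in
/-- **sum-coordinate projection from a `σ`-split**: if `σ ∘ π(x) ∘ σ⁻¹ = π(y) ⊕ π(z)` (the `LinearEquiv` clause), then
`π(sumTransport_σ x) = π(y) ⊕ π(z)` in `Sp(𝕎^𝔻_{V₁} ⊕ 𝕎^𝔻_{V₂})` (★ `coe_proj_sumTransport_apply`; stated for GENERAL elements —
instantiating at Weil's `δ`'s afterwards keeps `isDefEq` off the `r_Δ` telescope). [cite: Kudla1984, §1]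
[cite: MoeglinVignerasWaldspurger1987, Chap. 2 II.1 (A)] -/
theorem proj_sumTransport_of_split (x : MpD L eV dV hdV dW hdW) (y : MpD L eA dA hdA dW hdW) (z : MpD L eB dB hdB dW hdW)
    (hxyz : (UnitaryGroup.spReindex (idxSplitD eV eA eB) (gramDA L eV dV hdV dW hdW) (projD L eV dV hdV dW hdW x)).1 =
      (UnitaryGroup.spSum (gramDA L eA dA hdA dW hdW) (gramDA L eB dB hdB dW hdW)
        (projD L eA dA hdA dW hdW y, projD L eB dB hdB dW hdW z)).1) :
    adelicMpCont.proj (Fp L) (Fin (n₁ + n₁) ⊕ Fin (n₂ + n₂))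
        (Matrix.fromBlocks (gramDA L eA dA hdA dW hdW) 0 0 (gramDA L eB dB hdB dW hdW))
        (sumTransport (Fp L) (idxSplitD eV eA eB)
          (reindex_idxSplitD_gramDA L eV eA eB dA hdA dB hdB dV hdV hVA hVB dW hdW) x) =
      UnitaryGroup.spSum (gramDA L eA dA hdA dW hdW) (gramDA L eB dB hdB dW hdW)
        (projD L eA dA hdA dW hdW y, projD L eB dB hdB dW hdW z) :=
  Subtype.ext (LinearEquiv.ext fun w =>
    (coe_proj_sumTransport_apply (Fp L) (idxSplitD eV eA eB)
        (reindex_idxSplitD_gramDA L eV eA eB dA hdA dB hdB dV hdV hVA hVB dW hdW) x w).trans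
      (LinearEquiv.congr_fun hxyz w))

include hVA hVB hdA0 hdB0 hdW0 in
/-- **the see-saw scalar of a `σ`-split triple, in sum coordinates** (★ `exists_ne_zero_smul_tensorToSum_of_fst_eq_spSum`; general
elements): ONE `κ ≠ 0` with `ω(sumTransport_σ x) (Φ₁ ⊠ Φ₂) = κ • (ω(y) Φ₁ ⊠ ω(z) Φ₂)`.
[cite: Weil1964, Chap. III n° 37–38 pp. 187–189] [cite: Kudla1984, §1] -/
theorem exists_seesaw_scalar_sum_of_split (x : MpD L eV dV hdV dW hdW) (y : MpD L eA dA hdA dW hdW)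
    (z : MpD L eB dB hdB dW hdW)
    (hxyz : (UnitaryGroup.spReindex (idxSplitD eV eA eB) (gramDA L eV dV hdV dW hdW) (projD L eV dV hdV dW hdW x)).1 =
      (UnitaryGroup.spSum (gramDA L eA dA hdA dW hdW) (gramDA L eB dB hdB dW hdW)
        (projD L eA dA hdA dW hdW y, projD L eB dB hdB dW hdW z)).1) :
    ∃ κ : ℂ, κ ≠ 0 ∧
    ∀ (Φ₁ : piSchwartzBruhat (Fp L) (Fin (n₁ + n₁))) (Φ₂ : piSchwartzBruhat (Fp L) (Fin (n₂ + n₂))),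
      adelicMpCont.omega (Fp L) (Fin (n₁ + n₁) ⊕ Fin (n₂ + n₂))
          (Matrix.fromBlocks (gramDA L eA dA hdA dW hdW) 0 0 (gramDA L eB dB hdB dW hdW))
          (sumTransport (Fp L) (idxSplitD eV eA eB)
            (reindex_idxSplitD_gramDA L eV eA eB dA hdA dB hdB dV hdV hVA hVB dW hdW) x)
          (tensorToSum (Fp L) (Fin (n₁ + n₁)) (Fin (n₂ + n₂)) Φ₁ Φ₂) =
        κ • tensorToSum (Fp L) (Fin (n₁ + n₁)) (Fin (n₂ + n₂))
          (adelicMpCont.omega (Fp L) (Fin (n₁ + n₁)) (gramDA L eA dA hdA dW hdW) y Φ₁)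
          (adelicMpCont.omega (Fp L) (Fin (n₂ + n₂)) (gramDA L eB dB hdB dW hdW) z Φ₂) :=
  exists_ne_zero_smul_tensorToSum_of_fst_eq_spSum (isUnit_gramDA' L dW hdW hdW0 eA dA hdA hdA0)
    (isUnit_gramDA' L dW hdW hdW0 eB dB hdB hdB0) y y.2 z z.2
    (sumTransport (Fp L) (idxSplitD eV eA eB)
      (reindex_idxSplitD_gramDA L eV eA eB dA hdA dB hdB dV hdV hVA hVB dW hdW) x)
    (sumTransport (Fp L) (idxSplitD eV eA eB)
      (reindex_idxSplitD_gramDA L eV eA eB dA hdA dB hdB dV hdV hVA hVB dW hdW) x).2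
    (proj_sumTransport_of_split L eV eA eB dA hdA dB hdB dV hdV hVA hVB dW hdW x y z hxyz)

set_option maxHeartbeats 3200000 in
-- (measured ∈ (800 k, 1.6 M]: one 2× line, B30)
include hVA hVB hdA0 hdB0 hdW0 in
/-- **the see-saw scalar of a `σ`-split triple, in the original coordinates** (general elements): ONE `κ ≠ 0` with
`ω(x) (sumTensor_σ Φ₁ Φ₂) = κ • sumTensor_σ (ω(y) Φ₁) (ω(z) Φ₂)`. [cite: Weil1964, Chap. III n° 37–38 pp. 187–189] [cite: Kudla1984, §1] -/
theorem exists_seesaw_scalar_of_split (x : MpD L eV dV hdV dW hdW) (y : MpD L eA dA hdA dW hdW) (z : MpD L eB dB hdB dW hdW)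
    (hxyz : (UnitaryGroup.spReindex (idxSplitD eV eA eB) (gramDA L eV dV hdV dW hdW) (projD L eV dV hdV dW hdW x)).1 =
      (UnitaryGroup.spSum (gramDA L eA dA hdA dW hdW) (gramDA L eB dB hdB dW hdW)
        (projD L eA dA hdA dW hdW y, projD L eB dB hdB dW hdW z)).1) :
    ∃ κ : ℂ, κ ≠ 0 ∧
    ∀ (Φ₁ : piSchwartzBruhat (Fp L) (Fin (n₁ + n₁))) (Φ₂ : piSchwartzBruhat (Fp L) (Fin (n₂ + n₂))),
      adelicMpCont.omega (Fp L) (Fin (n + n)) (gramDA L eV dV hdV dW hdW) x (sumTensor (Fp L) (idxSplitD eV eA eB) Φ₁ Φ₂) =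
        κ • sumTensor (Fp L) (idxSplitD eV eA eB)
          (adelicMpCont.omega (Fp L) (Fin (n₁ + n₁)) (gramDA L eA dA hdA dW hdW) y Φ₁)
          (adelicMpCont.omega (Fp L) (Fin (n₂ + n₂)) (gramDA L eB dB hdB dW hdW) z Φ₂) := by
  obtain ⟨κ, hκ, h⟩ := exists_seesaw_scalar_sum_of_split L eV eA eB dA hdA hdA0 dB hdB hdB0 dV hdV hVA hVB dW hdW hdW0
    x y z hxyz
  refine ⟨κ, hκ, fun Φ₁ Φ₂ => ?_⟩
  have h' := (omega_sumTransport_apply (Fp L) (idxSplitD eV eA eB)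
    (reindex_idxSplitD_gramDA L eV eA eB dA hdA dB hdB dV hdV hVA hVB dW hdW) x
    (tensorToSum (Fp L) (Fin (n₁ + n₁)) (Fin (n₂ + n₂)) Φ₁ Φ₂)).symm.trans (h Φ₁ Φ₂)
  exact (((piSBReindex (Fp L) (idxSplitD eV eA eB)).symm_apply_apply _).symm.trans
    (congrArg (piSBReindex (Fp L) (idxSplitD eV eA eB)).symm h')).trans (LinearEquiv.map_smul _ _ _)

include hVA hVB hdA0 hdB0 hdW0 in
/-- **The see-saw scalar of Weil's `δ`'s** (§6 `proj_rDelta_split`): ONE `κ ≠ 0` with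
`ω(r_Δ V) (sumTensor_σ Φ₁ Φ₂) = κ • sumTensor_σ (ω(r_Δ V₁) Φ₁) (ω(r_Δ V₂) Φ₂)` for all `Φ₁, Φ₂`.
[cite: Weil1964, Chap. III n° 37–38 pp. 187–189] [cite: Kudla1984, §1] [cite: Kudla1994, §2 (doubled space, Siegel parabolic)] -/
theorem exists_kappa : ∃ κ : ℂ, κ ≠ 0 ∧
    ∀ (Φ₁ : piSchwartzBruhat (Fp L) (Fin (n₁ + n₁))) (Φ₂ : piSchwartzBruhat (Fp L) (Fin (n₂ + n₂))),
      adelicMpCont.omega (Fp L) (Fin (n + n)) (gramDA L eV dV hdV dW hdW) (rDelta L eV dV hdV hdV0 dW hdW hdW0)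
          (sumTensor (Fp L) (idxSplitD eV eA eB) Φ₁ Φ₂) =
        κ • sumTensor (Fp L) (idxSplitD eV eA eB)
          (adelicMpCont.omega (Fp L) (Fin (n₁ + n₁)) (gramDA L eA dA hdA dW hdW) (rDelta L eA dA hdA hdA0 dW hdW hdW0) Φ₁)
          (adelicMpCont.omega (Fp L) (Fin (n₂ + n₂)) (gramDA L eB dB hdB dW hdW) (rDelta L eB dB hdB hdB0 dW hdW hdW0) Φ₂) :=
  exists_seesaw_scalar_of_split L eV eA eB dA hdA hdA0 dB hdB hdB0 dV hdV hVA hVB dW hdW hdW0 _ _ _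
    (proj_rDelta_split L eV eA eB (dW := dW) (hdW := hdW) dA hdA hdA0 dB hdB hdB0 dV hdV hdV0 hVA hVB hdW0)

/-! ### §7.2 The see-saw triple `(sD_V ∘ blkD, sD_{V₁} ∘ pr₁, sD_{V₂} ∘ pr₂)` and its character -/

variable (χ : HeckeCharacter L)
  {sDV : HA L eV dV hdV dW hdW →* MpD L eV dV hdV dW hdW}
  {sDA : HA L eA dA hdA dW hdW →* MpD L eA dA hdA dW hdW}
  {sDB : HA L eB dB hdB dW hdW →* MpD L eB dB hdB dW hdW}

/-- **The hypothesis `hS` of ★ `mpSeesawCharSum`** for `(sD_V ∘ blkD, sD_{V₁} ∘ pr₁, sD_{V₂} ∘ pr₂)`: §4 `toSpD_blkD` after the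
three `proj_eq` clauses. [cite: Kudla1984, §1] [cite: Kudla1994, §2 (doubled space, Siegel parabolic)] -/
theorem spReindex_proj_comp_blkD (hDV : IsDoubledWeilRep L eV dV hdV hdV0 dW hdW hdW0 χ sDV)
    (hDA : IsDoubledWeilRep L eA dA hdA hdA0 dW hdW hdW0 χ sDA) (hDB : IsDoubledWeilRep L eB dB hdB hdB0 dW hdW hdW0 χ sDB)
    (p : HA L eA dA hdA dW hdW × HA L eB dB hdB dW hdW) :
    (UnitaryGroup.spReindex (idxSplitD eV eA eB) (gramDA L eV dV hdV dW hdW)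
        (projD L eV dV hdV dW hdW ((sDV.comp (blkD L eV eA eB dA hdA dB hdB dV hdV hVA hVB dW hdW)) p))).1 =
      (UnitaryGroup.spSum (gramDA L eA dA hdA dW hdW) (gramDA L eB dB hdB dW hdW)
        (projD L eA dA hdA dW hdW ((sDA.comp (MonoidHom.fst _ _)) p),
          projD L eB dB hdB dW hdW ((sDB.comp (MonoidHom.snd _ _)) p))).1 := by
  -- no `rw` in this currency (keyed matching on `DFunLike.coe` over the doubled telescopes is the isDefEq cliff): plain congruence
  have e1 : projD L eV dV hdV dW hdW (sDV (blkD L eV eA eB dA hdA dB hdB dV hdV hVA hVB dW hdW p)) =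
      toSpD L eV dV hdV dW hdW (blkD L eV eA eB dA hdA dB hdB dV hdV hVA hVB dW hdW p) := hDV.proj_eq _
  have e2 : projD L eA dA hdA dW hdW (sDA p.1) = toSpD L eA dA hdA dW hdW p.1 := hDA.proj_eq _
  have e3 : projD L eB dB hdB dW hdW (sDB p.2) = toSpD L eB dB hdB dW hdW p.2 := hDB.proj_eq _
  exact (congrArg (fun g => (UnitaryGroup.spReindex (idxSplitD eV eA eB) (gramDA L eV dV hdV dW hdW) g).1) e1).trans
    ((toSpD_blkD L eV eA eB dA hdA dB hdB dV hdV hVA hVB dW hdW p).trans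
      (congrArg₂ (fun gA gB => (UnitaryGroup.spSum (gramDA L eA dA hdA dW hdW) (gramDA L eB dB hdB dW hdW) (gA, gB)).1)
        e2 e3).symm)

include hVA hVB in
/-- **the see-saw character of the doubled triple** `(sD_V ∘ blkD, sD_{V₁} ∘ pr₁, sD_{V₂} ∘ pr₂)` along `σ` (★ `mpSeesawCharSum`):
`H(V₁)(𝔸) × H(V₂)(𝔸) →* ℂˣ`. [cite: Kudla1984, §1] [cite: GelbartRogawski1991, §3.1 Remark p. 457] -/
def seesawCharBlkD (hDV : IsDoubledWeilRep L eV dV hdV hdV0 dW hdW hdW0 χ sDV)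
    (hDA : IsDoubledWeilRep L eA dA hdA hdA0 dW hdW hdW0 χ sDA) (hDB : IsDoubledWeilRep L eB dB hdB hdB0 dW hdW hdW0 χ sDB) :
    HA L eA dA hdA dW hdW × HA L eB dB hdB dW hdW →* ℂˣ :=
  mpSeesawCharSum (idxSplitD eV eA eB) (reindex_idxSplitD_gramDA L eV eA eB dA hdA dB hdB dV hdV hVA hVB dW hdW)
    (sDV.comp (blkD L eV eA eB dA hdA dB hdB dV hdV hVA hVB dW hdW)) (sDA.comp (MonoidHom.fst _ _)) (sDB.comp (MonoidHom.snd _ _))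
    (spReindex_proj_comp_blkD L eV eA eB dA hdA hdA0 dB hdB hdB0 dV hdV hdV0 hVA hVB dW hdW hdW0 χ hDV hDA hDB)
    (isUnit_gramDA' L dW hdW hdW0 eA dA hdA hdA0) (isUnit_gramDA' L dW hdW hdW0 eB dB hdB hdB0)

/-- the defining identity of `seesawCharBlkD` on pure `σ`-tensors:
`ω(sD_V (blkD (h₁,h₂))) (Φ₁ ⊠_σ Φ₂) = c(h₁,h₂) • (ω(sD_{V₁} h₁) Φ₁ ⊠_σ ω(sD_{V₂} h₂) Φ₂)`. [cite: Kudla1984, §1] -/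
theorem seesawCharBlkD_spec (hDV : IsDoubledWeilRep L eV dV hdV hdV0 dW hdW hdW0 χ sDV)
    (hDA : IsDoubledWeilRep L eA dA hdA hdA0 dW hdW hdW0 χ sDA) (hDB : IsDoubledWeilRep L eB dB hdB hdB0 dW hdW hdW0 χ sDB)
    (h : HA L eA dA hdA dW hdW × HA L eB dB hdB dW hdW)
    (Φ₁ : piSchwartzBruhat (Fp L) (Fin (n₁ + n₁))) (Φ₂ : piSchwartzBruhat (Fp L) (Fin (n₂ + n₂))) :
    adelicMpCont.omega (Fp L) (Fin (n + n)) (gramDA L eV dV hdV dW hdW)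
        (sDV (blkD L eV eA eB dA hdA dB hdB dV hdV hVA hVB dW hdW h)) (sumTensor (Fp L) (idxSplitD eV eA eB) Φ₁ Φ₂) =
      (seesawCharBlkD L eV eA eB dA hdA hdA0 dB hdB hdB0 dV hdV hdV0 hVA hVB dW hdW hdW0 χ hDV hDA hDB h : ℂ) •
        sumTensor (Fp L) (idxSplitD eV eA eB)
          (adelicMpCont.omega (Fp L) (Fin (n₁ + n₁)) (gramDA L eA dA hdA dW hdW) (sDA h.1) Φ₁)
          (adelicMpCont.omega (Fp L) (Fin (n₂ + n₂)) (gramDA L eB dB hdB dW hdW) (sDB h.2) Φ₂) :=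
  mpSeesawCharSum_spec (idxSplitD eV eA eB) (reindex_idxSplitD_gramDA L eV eA eB dA hdA dB hdB dV hdV hVA hVB dW hdW)
    (sDV.comp (blkD L eV eA eB dA hdA dB hdB dV hdV hVA hVB dW hdW)) (sDA.comp (MonoidHom.fst _ _)) (sDB.comp (MonoidHom.snd _ _))
    (spReindex_proj_comp_blkD L eV eA eB dA hdA hdA0 dB hdB hdB0 dV hdV hdV0 hVA hVB dW hdW hdW0 χ hDV hDA hDB)
    (isUnit_gramDA' L dW hdW hdW0 eA dA hdA hdA0) (isUnit_gramDA' L dW hdW hdW0 eB dB hdB hdB0) h Φ₁ Φ₂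

/-! ### §7.3 `hQ`: the see-saw character is `1` at the Siegel points `(q, 1)` -/

/-- **`hQ` — the parabolic comparison**: for `q ∈ P_Δ(V₁)(𝔸)` with unit `det_Δ q`, the see-saw character of
`(sD_V ∘ blkD, sD_{V₁}, sD_{V₂})` is `1` at `(q, 1)`.  PROOF: V's parabolic clause at `p = blkD (q,1)` on
`Ψ := testVec ⊠_σ testVec` and V₁'s at `testVec`, read through `κ` (§7.1) and the defining identity of the character, give
`c · χ(det_Δ q)|det_Δ q|^{1/2} = χ(det_Δ (blkD (q,1)))|det_Δ (blkD (q,1))|^{1/2}`, and §5 `chiDet_mul_modDelta_blkD_inl` says the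
two prescribed scalars agree. [cite: Kudla1994, §2 (doubled space, Siegel parabolic), Thm. 3.1] [cite: HarrisKudlaSweet1996, §1 (1.14)–(1.15)] -/
theorem seesawCharBlkD_eq_one_of_isSiegelDelta (hDV : IsDoubledWeilRep L eV dV hdV hdV0 dW hdW hdW0 χ sDV)
    (hDA : IsDoubledWeilRep L eA dA hdA hdA0 dW hdW hdW0 χ sDA) (hDB : IsDoubledWeilRep L eB dB hdB hdB0 dW hdW hdW0 χ sDB)
    {q : HA L eA dA hdA dW hdW} (hq : IsSiegelDelta L eA dA hdA dW hdW q) (hqu : IsUnit (detDelta L eA dA hdA dW hdW q)) :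
    seesawCharBlkD L eV eA eB dA hdA hdA0 dB hdB hdB0 dV hdV hdV0 hVA hVB dW hdW hdW0 χ hDV hDA hDB (q, 1) = 1 := by
  obtain ⟨κ, hκ0, hκ⟩ := exists_kappa L eV eA eB dA hdA hdA0 dB hdB hdB0 dV hdV hdV0 hVA hVB dW hdW hdW0
  -- Siegel data of `blkD (q, 1)`
  have h1u : IsUnit (detDelta L eB dB hdB dW hdW (1 : HA L eB dB hdB dW hdW)) := by
    rw [detDelta_one']; exact isUnit_one
  have hp : IsSiegelDelta L eV dV hdV dW hdW (blkD L eV eA eB dA hdA dB hdB dV hdV hVA hVB dW hdW (q, 1)) :=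
    isSiegelDelta_blkD L eV eA eB dA hdA dB hdB dV hdV hVA hVB dW hdW hq (isSiegelDelta_one' L eB dB hdB dW hdW)
  have hpu : IsUnit (detDelta L eV dV hdV dW hdW (blkD L eV eA eB dA hdA dB hdB dV hdV hVA hVB dW hdW (q, 1))) :=
    isUnit_detDelta_blkD L eV eA eB dA hdA dB hdB dV hdV hVA hVB dW hdW (h := (q, 1)) hqu h1u
  -- the two parabolic clauses, `ω` of a triple product unfolded
  have hparV := hDV.parabolic _ hp hpu (sumTensor (Fp L) (idxSplitD eV eA eB) (testVec L) (testVec L))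
  have hparA := hDA.parabolic q hq hqu (testVec L)
  rw [opD_mul, opD_mul] at hparV hparA
  -- the two prescribed scalars agree
  have hm := chiDet_mul_modDelta_blkD_inl L eV eA eB dA hdA dB hdB dV hdV hVA hVB dW hdW χ (p := q) hqu
  have hmA : ((chiDet L eA dA hdA dW hdW χ q : ℂˣ) : ℂ) * (modDelta L eA dA hdA dW hdW q : ℂ) ≠ 0 :=
    mul_ne_zero (Units.ne_zero _) (Complex.ofReal_ne_zero.2 (modDelta_ne_zero' L dW hdW eA dA hdA q))
  -- assemble by the abstract lemma
  refine Units.val_eq_one.mp ?_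
  exact seesaw_scalar_eq_one_of_parabolic
    (sumTensor (Fp L) (idxSplitD eV eA eB))
    (fun Φ => ((Φ : piSchwartzBruhat (Fp L) (Fin (n + n))) : (Fin (n + n) → 𝔸⁺) → ℂ) 0)
    (fun Φ => ((Φ : piSchwartzBruhat (Fp L) (Fin (n₁ + n₁))) : (Fin (n₁ + n₁) → 𝔸⁺) → ℂ) 0)
    (fun Φ => ((Φ : piSchwartzBruhat (Fp L) (Fin (n₂ + n₂))) : (Fin (n₂ + n₂) → 𝔸⁺) → ℂ) 0)
    (fun a z => rfl) (fun x y => by rw [coe_sumTensor_apply]; rfl)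
    (adelicMpCont.omega (Fp L) (Fin (n + n)) (gramDA L eV dV hdV dW hdW) (rDelta L eV dV hdV hdV0 dW hdW hdW0))
    (adelicMpCont.omega (Fp L) (Fin (n + n)) (gramDA L eV dV hdV dW hdW) (rDelta L eV dV hdV hdV0 dW hdW hdW0)⁻¹)
    (adelicMpCont.omega (Fp L) (Fin (n + n)) (gramDA L eV dV hdV dW hdW)
      (sDV (blkD L eV eA eB dA hdA dB hdB dV hdV hVA hVB dW hdW (q, 1))))
    (adelicMpCont.omega (Fp L) (Fin (n₁ + n₁)) (gramDA L eA dA hdA dW hdW) (rDelta L eA dA hdA hdA0 dW hdW hdW0))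
    (adelicMpCont.omega (Fp L) (Fin (n₁ + n₁)) (gramDA L eA dA hdA dW hdW) (rDelta L eA dA hdA hdA0 dW hdW hdW0)⁻¹)
    (adelicMpCont.omega (Fp L) (Fin (n₁ + n₁)) (gramDA L eA dA hdA dW hdW) (sDA q))
    (adelicMpCont.omega (Fp L) (Fin (n₂ + n₂)) (gramDA L eB dB hdB dW hdW) (rDelta L eB dB hdB hdB0 dW hdW hdW0))
    (adelicMpCont.omega (Fp L) (Fin (n₂ + n₂)) (gramDA L eB dB hdB dW hdW) (rDelta L eB dB hdB hdB0 dW hdW hdW0)⁻¹)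
    (adelicMpCont.omega (Fp L) (Fin (n₂ + n₂)) (gramDA L eB dB hdB dW hdW) (sDB 1))
    (fun z => rep_inv_apply_apply _ _ z) (fun x => rep_apply_inv_apply _ _ x) (fun y => rep_apply_inv_apply _ _ y)
    (fun y => by simp only [map_one, Module.End.one_apply])
    κ _ _ _ hκ0 hmA hm hκ
    (fun x y => seesawCharBlkD_spec L eV eA eB dA hdA hdA0 dB hdB hdB0 dV hdV hdV0 hVA hVB dW hdW hdW0 χ hDV hDA hDB (q, 1) x y)
    (testVec L) (testVec L) (testVec_zero L) (testVec_zero L) hparV hparA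

/-! ### §7.4 The doubled conclusion: the see-saw character is `1` on `H(V₁)(𝔸) × 1` -/

/-- **THE DOUBLED SEE-SAW CONCLUSION.**  For the `χ`-normalised doubled Weil representations `sD_V, sD_{V₁}, sD_{V₂}` of
`V = V₁ ⊕ V₂` (same partner `W`), the see-saw character of `(sD_V ∘ blkD, sD_{V₁} ∘ pr₁, sD_{V₂} ∘ pr₂)` is `1` on `H(V₁)(𝔸) × 1`:
`ω(sD_V (blkD (h₁, 1))) (Φ₁ ⊠_σ Φ₂) = ω(sD_{V₁} h₁) Φ₁ ⊠_σ Φ₂`.  By `hQ` (§7.3) at the Siegel points and RIGIDITY (`DoubledSeesawCharacterRigid`):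
`H(V₁)(𝔸)` has no continuous character trivial on `P_Δ(V₁)(𝔸)` that twists `sD_{V₁}`.
[cite: Liu2021, Thm. 4.15 proof l. 2199–2210] [cite: Kudla1984, §1] [cite: GelbartRogawski1991, §3.1 Prop. 3.1.1 p. 455, Remark p. 457] -/
theorem seesawCharBlkD_inl_eq_one (hχu : χ.IsUnitary) (hχs : IsSplittingChar L 1 χ)
    (hDV : IsDoubledWeilRep L eV dV hdV hdV0 dW hdW hdW0 χ sDV)
    (hDA : IsDoubledWeilRep L eA dA hdA hdA0 dW hdW hdW0 χ sDA) (hDB : IsDoubledWeilRep L eB dB hdB hdB0 dW hdW hdW0 χ sDB)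
    (h₁ : HA L eA dA hdA dW hdW) :
    seesawCharBlkD L eV eA eB dA hdA hdA0 dB hdB hdB0 dV hdV hdV0 hVA hVB dW hdW hdW0 χ hDV hDA hDB (h₁, 1) = 1 := by
  unfold seesawCharBlkD
  exact mpSeesawCharSum_inl_eq_one_of_rigid (idxSplitD eV eA eB)
    (reindex_idxSplitD_gramDA L eV eA eB dA hdA dB hdB dV hdV hVA hVB dW hdW)
    (sDV.comp (blkD L eV eA eB dA hdA dB hdB dV hdV hVA hVB dW hdW)) sDA sDB
    (spReindex_proj_comp_blkD L eV eA eB dA hdA hdA0 dB hdB hdB0 dV hdV hdV0 hVA hVB dW hdW hdW0 χ hDV hDA hDB)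
    (isUnit_gramDA' L dW hdW hdW0 eA dA hdA hdA0) (isUnit_gramDA' L dW hdW hdW0 eB dB hdB hdB0)
    (hDV.continuous.comp (continuous_blkD L eV eA eB dA hdA dB hdB dV hdV hVA hVB dW hdW)) hDA.continuous hDB.continuous
    {q | IsSiegelDelta L eA dA hdA dW hdW q ∧ IsUnit (detDelta L eA dA hdA dW hdW q)}
    (fun q hq => seesawCharBlkD_eq_one_of_isSiegelDelta L eV eA eB dA hdA hdA0 dB hdB hdB0 dV hdV hdV0 hVA hVB dW hdW hdW0 χ
      hDV hDA hDB hq.1 hq.2)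
    (fun η hηc hη => IsDoubledWeilRep.monoidHom_eq_one_of_forall_isSiegelDelta L eA dA hdA hdA0 dW hdW hdW0 χ hχu hχs hDA η hηc
      fun p hp hu => hη p ⟨hp, hu⟩)
    h₁

set_option maxHeartbeats 1600000 in
-- (measured ∈ (400 k, 800 k]: one 2× line, B30)
/-- **The doubled see-saw conclusion read on pure `σ`-tensors**: `ω(sD_V (blkD (h₁, 1))) (Φ₁ ⊠_σ Φ₂) = ω(sD_{V₁} h₁) Φ₁ ⊠_σ Φ₂`.
[cite: Liu2021, Thm. 4.15 proof l. 2199–2210] [cite: Kudla1984, §1] -/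
theorem omega_blkD_inl_sumTensor (hχu : χ.IsUnitary) (hχs : IsSplittingChar L 1 χ)
    (hDV : IsDoubledWeilRep L eV dV hdV hdV0 dW hdW hdW0 χ sDV)
    (hDA : IsDoubledWeilRep L eA dA hdA hdA0 dW hdW hdW0 χ sDA) (hDB : IsDoubledWeilRep L eB dB hdB hdB0 dW hdW hdW0 χ sDB)
    (h₁ : HA L eA dA hdA dW hdW)
    (Φ₁ : piSchwartzBruhat (Fp L) (Fin (n₁ + n₁))) (Φ₂ : piSchwartzBruhat (Fp L) (Fin (n₂ + n₂))) :
    adelicMpCont.omega (Fp L) (Fin (n + n)) (gramDA L eV dV hdV dW hdW)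
        (sDV (blkD L eV eA eB dA hdA dB hdB dV hdV hVA hVB dW hdW (h₁, 1))) (sumTensor (Fp L) (idxSplitD eV eA eB) Φ₁ Φ₂) =
      sumTensor (Fp L) (idxSplitD eV eA eB)
        (adelicMpCont.omega (Fp L) (Fin (n₁ + n₁)) (gramDA L eA dA hdA dW hdW) (sDA h₁) Φ₁) Φ₂ := by
  have h := seesawCharBlkD_spec L eV eA eB dA hdA hdA0 dB hdB hdB0 dV hdV hdV0 hVA hVB dW hdW hdW0 χ hDV hDA hDB (h₁, 1) Φ₁ Φ₂
  -- (no `rw … at h`: keyed matching over the doubled telescopes is the isDefEq cliff; plain congruence instead)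
  have hc : (seesawCharBlkD L eV eA eB dA hdA hdA0 dB hdB hdB0 dV hdV hdV0 hVA hVB dW hdW hdW0 χ hDV hDA hDB (h₁, 1) : ℂ) = 1 := by
    rw [seesawCharBlkD_inl_eq_one L eV eA eB dA hdA hdA0 dB hdB hdB0 dV hdV hdV0 hVA hVB dW hdW hdW0 χ hχu hχs hDV hDA hDB h₁,
      Units.val_one]
  have e : adelicMpCont.omega (Fp L) (Fin (n₂ + n₂)) (gramDA L eB dB hdB dW hdW) (sDB 1) Φ₂ = Φ₂ := by
    rw [map_one, map_one, Module.End.one_apply]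
  exact h.trans (((congrArg (· • _) hc).trans (one_smul ℂ _)).trans (congrArg (sumTensor (Fp L) (idxSplitD eV eA eB) _) e))

end R1b

end Literature.NumberTheory.GelbartRogawski1991.GRConstruction

end
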